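import Summits.QuantumFields.YangMills.Theorems.BalabanUVNodesPortS1G3CStepSum
import Summits.QuantumFields.YangMills.Theorems.BalabanUVNodesPortS1G3CBlockSchur
import Summits.QuantumFields.YangMills.Theorems.BalabanUVNodesPortS1G3CNeumann

/-!
# NODE O port PT-A — `stub_G3C` (repaired edition `G3CAtRecordL`), layer (β″): THE NEUMANN SERIES AT `X_full` — `‖R(x, φ)‖ ≤ Λ₀ ≤ ½` by the block Schur test whenever the point
# predicate holds at the whole torus, hence `Σ_X W(X)(x, φ) = Tr (x·1 + [TC n φ]_{nonB₀})⁻¹` (so the collector piece `EG(X_full)` IS the walk piece `W(X_full)` there)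

Cell `ym-nodeO-ideate`, porter hand `hand-27930-G3C` (g1); `--supports stmt-QuantumFields-27930`; count-neutral.  [16] = [Balaban1985UV3], [B9] = [Balaban1985BackgroundPropagators],
[I] = [Balaban1987RG1], [II] = [Balaban1988RG2Cluster].

WHY (memo §5c, rows (g2)(g3)(g5) for `X_full`; [B9] (3.96) p.411 «the series (3.90) is convergent»).  `EG := collect X_full W (Tr A⁻¹)` (✓`g3cEG`) satisfies (g1) for every pair by bookkeeping; to give
it the bound and the holomorphy of the walk piece one needs `EG(X_full) = W(X_full)` on the open set `O_{X_full}`, i.e. `Σ_X W(X) = Tr A⁻¹` there.  With `A·C₀ = 1 + R` (✓`g3c_parametrix_of_coer`)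
and `Σ_X W_m(X) = Tr[C₀Rᵐ]` (✓`sum_g3cWm_eq_trace`) this is the Neumann series `A⁻¹ = C₀Σ(−R)ᵐ` (✓`G3CInv.hasSum_parametrix_trace_block`), which needs `‖R‖ < 1`: the blocks `𝟙_{b′}R𝟙_b`
of `R = Σ S^M_{□,Y}` are `Σ_{Y ∋ b′, Y ∩ b̃ ≠ ∅} S^M_{b,Y}` (✓`g3cInd_mul_g3cStepM_of_not_mem`, ✓`g3cStepM_eq_zero_of_disjoint`, `𝟙_□𝟙_b = 0` for `□ ≠ b`), of norm `≤ Σ_Y f₀(b′; b, Y)` (the step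
weight at `κt = 0`, ✓`norm_g3cStepM_le_bd`); the ROW block sums are one-step sums `≤ Λ₀ := g3cLam(…, κt = 0)` (✓`sum_g3cStepWt_le`), the COLUMN block sums `Σ_Y #Y·𝟙[Y ∩ b̃ ≠ ∅]·b(b, Y)`
are `≤ Λ₀` by the same combinatorics charged to the `≤ 81` cubes of `b̃`; ✓`G3CCT.l2_opNorm_le_of_blockSchur` gives `‖R‖ ≤ Λ₀ ≤ Λ ≤ ½`.

WHAT THIS FILE PROVES (sorry-free): `g3cInd_eq_diagonal`, `g3cInd_mul_g3cInd_of_ne`, ★`norm_ind_mul_g3cR_mul_ind_le`, `sum_g3cStepWt_fst_le` (column block sums), `g3cLam_zero_le`,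
★`l2_opNorm_g3cR_le` (`‖R‖ ≤ g3cLam(…,0)`), `summable_g3cWm`, `hasSum_g3cW`, ★★`sum_g3cW_eq_trace_inv` and `g3cEG_eq_g3cW_of_pt` (`EG = W` at every pair of `G3CPt … X_full φ` with `Λ ≤ ½`).

HONEST FRAMING.  Finite-dimensional linear algebra under point hypotheses (asserted for nothing); nothing of Bałaban asserted, ported or discharged; `stub_G3C` NOT closed; 27930 OPEN;
NODE O 0∕1; COUNT 8∕28 · K 1∕4 UNMOVED; finite `𝕋⁴_{L^K}` at fixed ε — NOT continuum ∕ OS ∕ Clay; **the Yang–Mills mass gap is NOT proved by any of this.**  No `sorry`, no `instance`,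
no `notation`; standard axioms.
-/

noncomputable section

open scoped BigOperators Matrix.Norms.L2Operator Topology Matrix Classical
open Filter Finset

namespace Summit.QuantumFields.YangMills.Theorems.BalabanUVNodesPortS1

open Summit.QuantumFields.YangMills.Theorems.K0RecordFormatNames
open Literature.MathematicalPhysics.QuantumFieldTheory.Balaban1983to89
open Literature.MathematicalPhysics.QuantumFieldTheory.Balaban1983to89.Node00
open Literature.MathematicalPhysics.QuantumFieldTheory.Balaban1983to89.T4Continuum (T4Family)
open Literature.MathematicalPhysics.QuantumFieldTheory.Balaban1983to89.TreeLengthTorus (TPt IsTDom TFaceConnected torusTreeLen torusTreeLen_nonneg)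
open Literature.MathematicalPhysics.QuantumFieldTheory.Balaban1983to89.TreeLengthTorusTransfer (tblock tcollar card_tblock_le card_tcollar_le)
open Literature.MathematicalPhysics.QuantumFieldTheory.Balaban1983to89.B12TreeDecay (K₀ kappa₀ K₀_pos kappa₀_nonneg)
open Literature.MathematicalPhysics.QuantumFieldTheory.Balaban1983to89.B5Prop11Lower (nsq nsq_nonneg)

/-! ## §1  The sharp partition as `ℂ`-indicator diagonals -/

section Ind

variable {F : T4Family}

/-- `𝟙_□` as a `ℂ`-valued indicator diagonal (the form of ✓`G3CCT.l2_opNorm_le_of_blockSchur`). [folklore] -/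
theorem g3cInd_eq_diagonal (Mc k K : ℕ) (q : TPt (F.P K).d (Sect2.domCount (F.P K) Mc (k + 1))) :
    g3cInd F Mc k K q = Matrix.diagonal fun i : NonB0Idx F k K => if cubeOfSite F Mc k K (blockOf i.1.1.src) = q then (1 : ℂ) else 0 := by
  rw [g3cInd]; congr 1; funext i; split_ifs <;> simp

/-- `𝟙_□·𝟙_b = 0` for `□ ≠ b`. [folklore] -/
theorem g3cInd_mul_g3cInd_of_ne (Mc k K : ℕ) {q b : TPt (F.P K).d (Sect2.domCount (F.P K) Mc (k + 1))} (h : q ≠ b) :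
    g3cInd F Mc k K q * g3cInd F Mc k K b = 0 := by
  rw [g3cInd_eq_diagonal, g3cInd_eq_diagonal, Matrix.diagonal_mul_diagonal, ← Matrix.diagonal_zero]
  congr 1; funext i
  by_cases h1 : cubeOfSite F Mc k K (blockOf i.1.1.src) = q
  · rw [if_pos h1, if_neg (fun h2 => h (h1.symm.trans h2))]; simp
  · rw [if_neg h1]; simp

end Ind

/-! ## §2  The blocks of `R` against the step weight at `κt = 0` -/

section Blocks

variable {F : T4Family}
variable {a₀ δ₀ c₀ γ₀ γ₁ δ₁ : ℝ} {Mc : ℕ} {α₀ α₁ ε₂₉ : ℝ} {k : ℕ}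
variable {TC : (n : ℕ) → Sect2.CPair (F.P (recordK₀ F Mc k + n)) (MatA 2) → FluctIdx F k (recordK₀ F Mc k + n) → FluctIdx F k (recordK₀ F Mc k + n) → ℂ}
variable {TY : (n : ℕ) → (recordDomSys F Mc k (recordK₀ F Mc k + n)).Dom → Sect2.CPair (F.P (recordK₀ F Mc k + n)) (MatA 2) →
  FluctIdx F k (recordK₀ F Mc k + n) → FluctIdx F k (recordK₀ F Mc k + n) → ℂ}
variable {TZY : Finset (Fin 4 → ℤ) → IntBondCfg → ((Fin 4 → ℤ) × Fin 4) × Fin 3 → ((Fin 4 → ℤ) × Fin 4) × Fin 3 → ℂ}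
variable {AdM : (n : ℕ) → (Site (F.P (recordK₀ F Mc k + n)) 0 → (MatA 2)ˣ) →
  Matrix (FluctIdx F k (recordK₀ F Mc k + n)) (FluctIdx F k (recordK₀ F Mc k + n)) ℂ}
variable {AdZ : ((Fin 4 → ℤ) → (MatA 2)ˣ) → (Fin 4 → ℤ) × Fin 4 → Matrix (Fin 3) (Fin 3) ℂ}

/-- **One step inside one block**: `‖𝟙_{b′}·S^M_{□,Y}·𝟙_b‖ ≤ 𝟙[□ = b]·f₀(b′; □, Y)` at a pair of `G3CPt … X_full φ` (`x ≥ 0`). [cite: Balaban1985BackgroundPropagators, (3.90) p.409, (3.96) p.411] -/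
theorem norm_ind_mul_g3cStepM_mul_ind_le (hP : P0CarrierClauses F a₀ δ₀ c₀ γ₀ γ₁ Mc α₀ α₁ ε₂₉ k TC TY TZY AdM AdZ) (hMc : McGuard F Mc) {c γ δ₁' κ' : ℝ} (hc : 0 ≤ c)
    (hγ : 0 < γ) (hδ₁ : 0 < δ₁') (hδ₀ : kappa₀ (4 * 2 ^ 4) (2 * 4) ≤ δ₀) (hκ : 0 ≤ κ') (hκδ : 2 * κ' ≤ δ₁') (hκc : 4 * κ' * (c * K₀ (4 * 2 ^ 4) (2 * 4)) ≤ γ * δ₁')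
    (n : ℕ) {φ : Sect2.CPair (F.P (recordK₀ F Mc k + n)) (MatA 2)}
    (hpt : G3CPt F Mc k (recordK₀ F Mc k + n) (TY n) c γ δ₀ δ₁' (g3cFull F Mc k (recordK₀ F Mc k + n)) φ) {x : ℝ} (hx : 0 ≤ x)
    (b' b : TPt (F.P (recordK₀ F Mc k + n)).d (Sect2.domCount (F.P (recordK₀ F Mc k + n)) Mc (k + 1)))
    (s : TPt (F.P (recordK₀ F Mc k + n)).d (Sect2.domCount (F.P (recordK₀ F Mc k + n)) Mc (k + 1)) × (recordDomSys F Mc k (recordK₀ F Mc k + n)).Dom) :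
    ‖g3cInd F Mc k (recordK₀ F Mc k + n) b' * g3cStepM F Mc k (recordK₀ F Mc k + n) (TY n) x φ s * g3cInd F Mc k (recordK₀ F Mc k + n) b‖ ≤
      (if s.1 = b then (1 : ℝ) else 0) * g3cStepWt F Mc k (recordK₀ F Mc k + n) c γ δ₀ κ' 0 b' s := by
  have hwt0 := g3cStepWt_nonneg Mc k (recordK₀ F Mc k + n) δ₀ κ' 0 hc hγ b' s (F := F)
  by_cases hq : s.1 = b
  · rw [if_pos hq, one_mul, g3cStepWt, zero_mul, Real.exp_zero, mul_one]
    by_cases hb' : b' ∈ (s.2.1 : Finset _)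
    · rw [if_pos hb', one_mul]
      by_cases hmeet : ((s.2.1 : Finset _) ∩ (g3cBlk F Mc k (recordK₀ F Mc k + n) s.1).1).Nonempty
      · rw [if_pos hmeet, one_mul]
        have h1 := l2_opNorm_g3cInd_le (F := F) Mc k (recordK₀ F Mc k + n) b'
        have h2 := l2_opNorm_g3cInd_le (F := F) Mc k (recordK₀ F Mc k + n) b
        have hS := norm_g3cStepM_le_bd hP hMc hc hγ hδ₁ hδ₀ hκ hκδ hκc n hpt hx s (fun c _ => mem_g3cFull F Mc k _ c) (fun c _ => mem_g3cFull F Mc k _ c)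
        have hbd0 := g3cStepBd_nonneg Mc k (recordK₀ F Mc k + n) δ₀ κ' hc hγ s (F := F)
        calc ‖g3cInd F Mc k (recordK₀ F Mc k + n) b' * g3cStepM F Mc k (recordK₀ F Mc k + n) (TY n) x φ s * g3cInd F Mc k (recordK₀ F Mc k + n) b‖
            ≤ ‖g3cInd F Mc k (recordK₀ F Mc k + n) b' * g3cStepM F Mc k (recordK₀ F Mc k + n) (TY n) x φ s‖ * ‖g3cInd F Mc k (recordK₀ F Mc k + n) b‖ := norm_mul_le _ _
          _ ≤ (‖g3cInd F Mc k (recordK₀ F Mc k + n) b'‖ * ‖g3cStepM F Mc k (recordK₀ F Mc k + n) (TY n) x φ s‖) * 1 :=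
              mul_le_mul (norm_mul_le _ _) h2 (norm_nonneg _) (by positivity)
          _ ≤ (1 * g3cStepBd F Mc k (recordK₀ F Mc k + n) c γ δ₀ κ' s) * 1 :=
              mul_le_mul_of_nonneg_right (mul_le_mul h1 hS (norm_nonneg _) zero_le_one) zero_le_one
          _ = _ := by ring
      · rw [if_neg hmeet, zero_mul]
        have hz : g3cStepM F Mc k (recordK₀ F Mc k + n) (TY n) x φ s = 0 :=
          g3cStepM_eq_zero_of_disjoint hP hMc n s (fun c hc hcb => hmeet ⟨c, Finset.mem_inter.2 ⟨hc, hcb⟩⟩) x φ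
        rw [hz, Matrix.mul_zero, Matrix.zero_mul, norm_zero]
    · rw [if_neg hb', zero_mul, zero_mul]
      rw [g3cInd_mul_g3cStepM_of_not_mem hP hMc n b' s hb' x φ, Matrix.zero_mul, norm_zero]
  · rw [if_neg hq, zero_mul]
    rw [Matrix.mul_assoc, ← g3cStepM_mul_g3cInd Mc k (TY n) x φ s, Matrix.mul_assoc, g3cInd_mul_g3cInd_of_ne Mc k _ hq, Matrix.mul_zero,
      Matrix.mul_zero, norm_zero]

/-- ★ **THE BLOCKS OF `R`**: `‖𝟙_{b′}·R(x, φ)·𝟙_b‖ ≤ Σ_Y f₀(b′; b, Y)` at a pair of `G3CPt … X_full φ`. [cite: Balaban1985BackgroundPropagators, (3.90) p.409, (3.96) p.411] -/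
theorem norm_ind_mul_g3cR_mul_ind_le (hP : P0CarrierClauses F a₀ δ₀ c₀ γ₀ γ₁ Mc α₀ α₁ ε₂₉ k TC TY TZY AdM AdZ) (hMc : McGuard F Mc) {c γ δ₁' κ' : ℝ} (hc : 0 ≤ c)
    (hγ : 0 < γ) (hδ₁ : 0 < δ₁') (hδ₀ : kappa₀ (4 * 2 ^ 4) (2 * 4) ≤ δ₀) (hκ : 0 ≤ κ') (hκδ : 2 * κ' ≤ δ₁') (hκc : 4 * κ' * (c * K₀ (4 * 2 ^ 4) (2 * 4)) ≤ γ * δ₁')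
    (n : ℕ) {φ : Sect2.CPair (F.P (recordK₀ F Mc k + n)) (MatA 2)}
    (hpt : G3CPt F Mc k (recordK₀ F Mc k + n) (TY n) c γ δ₀ δ₁' (g3cFull F Mc k (recordK₀ F Mc k + n)) φ) {x : ℝ} (hx : 0 ≤ x)
    (b' b : TPt (F.P (recordK₀ F Mc k + n)).d (Sect2.domCount (F.P (recordK₀ F Mc k + n)) Mc (k + 1))) :
    ‖g3cInd F Mc k (recordK₀ F Mc k + n) b' * g3cR F Mc k (recordK₀ F Mc k + n) (TC n) (TY n) x φ * g3cInd F Mc k (recordK₀ F Mc k + n) b‖ ≤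
      ∑ Y : (recordDomSys F Mc k (recordK₀ F Mc k + n)).Dom, g3cStepWt F Mc k (recordK₀ F Mc k + n) c γ δ₀ κ' 0 b' (b, Y) := by
  rw [g3cR_eq_sum_stepM hP n x φ, Finset.mul_sum, Finset.sum_mul]
  refine (norm_sum_le _ _).trans ?_
  calc ∑ s, ‖g3cInd F Mc k (recordK₀ F Mc k + n) b' * g3cStepM F Mc k (recordK₀ F Mc k + n) (TY n) x φ s * g3cInd F Mc k (recordK₀ F Mc k + n) b‖
      ≤ ∑ s : TPt (F.P (recordK₀ F Mc k + n)).d (Sect2.domCount (F.P (recordK₀ F Mc k + n)) Mc (k + 1)) × (recordDomSys F Mc k (recordK₀ F Mc k + n)).Dom,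
          (if s.1 = b then (1 : ℝ) else 0) * g3cStepWt F Mc k (recordK₀ F Mc k + n) c γ δ₀ κ' 0 b' s :=
        Finset.sum_le_sum fun s _ => norm_ind_mul_g3cStepM_mul_ind_le hP hMc hc hγ hδ₁ hδ₀ hκ hκδ hκc n hpt hx b' b s
    _ = ∑ Y : (recordDomSys F Mc k (recordK₀ F Mc k + n)).Dom, g3cStepWt F Mc k (recordK₀ F Mc k + n) c γ δ₀ κ' 0 b' (b, Y) := by
        rw [Fintype.sum_prod_type_right]
        refine Finset.sum_congr rfl fun Y _ => ?_
        have hq : ∀ q : TPt (F.P (recordK₀ F Mc k + n)).d (Sect2.domCount (F.P (recordK₀ F Mc k + n)) Mc (k + 1)),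
            (if (q, Y).1 = b then (1 : ℝ) else 0) * g3cStepWt F Mc k (recordK₀ F Mc k + n) c γ δ₀ κ' 0 b' (q, Y) =
              if q = b then g3cStepWt F Mc k (recordK₀ F Mc k + n) c γ δ₀ κ' 0 b' (q, Y) else 0 := by
          intro q
          by_cases h : q = b
          · rw [if_pos (show (q, Y).1 = b from h), if_pos h, one_mul]
          · rw [if_neg (show ¬ (q, Y).1 = b from h), if_neg h, zero_mul]
        rw [Finset.sum_congr rfl (fun q _ => hq q), Finset.sum_ite_eq' Finset.univ b, if_pos (Finset.mem_univ _)]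

end Blocks

/-! ## §3  The column block sums; monotonicity of `Λ` in `κt` -/

section Columns

variable {F : T4Family}

/-- **Column block sums**: `Σ_{b′} Σ_Y f₀(b′; b, Y) = Σ_Y #Y·𝟙[Y ∩ b̃ ≠ ∅]·b(b,Y) ≤ Λ₀ = g3cLam(…, 0)` (charge `Y` to one of the `≤ 81` cubes of `b̃` it meets; `#Y ≤ 80e^{d_j(Y)}`; (1.26)).
[cite: Balaban1985UV3, (25) p.262; Balaban1988RG2Cluster, (1.26) p.8, (2.27) p.18] -/
theorem sum_g3cStepWt_fst_le (Mc k K : ℕ) {c γ δ₀ : ℝ} (κ' : ℝ) (hc : 0 ≤ c) (hγ : 0 < γ) (hδ₀ : kappa₀ (4 * 2 ^ 4) (2 * 4) + 1 ≤ δ₀)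
    (b : TPt (F.P K).d (Sect2.domCount (F.P K) Mc (k + 1))) :
    ∑ b' : TPt (F.P K).d (Sect2.domCount (F.P K) Mc (k + 1)), ∑ Y : (recordDomSys F Mc k K).Dom, g3cStepWt F Mc k K c γ δ₀ κ' 0 b' (b, Y) ≤ g3cLam F Mc c γ δ₀ κ' 0 := by
  set κ₀ : ℝ := kappa₀ (4 * 2 ^ 4) (2 * 4) with hκ₀def
  have hκ₀ : 0 ≤ κ₀ := kappa₀_nonneg (by norm_num) _
  have hδ₀0 : 0 ≤ δ₀ := by linarith
  set Nn : ℝ := (((3 ^ 4 * 3 ^ 4 * (3 * 4 * (F.L * Mc) ^ 4) : ℕ) : ℝ) * (Real.exp (-(κ' * ((F.L * Mc : ℕ) : ℝ))) / (γ / 2))) with hNndef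
  have hNn0 : 0 ≤ Nn := by positivity
  set Afar : ℝ := c * (1 / γ) * Real.exp (-(δ₀ - 0 - 1 - κ₀)) with hAfar
  set Anear : ℝ := Real.exp (1 + κ₀) * (c * Nn) with hAnear
  have hAfar0 : 0 ≤ Afar := by positivity
  have hAnear0 : 0 ≤ Anear := by positivity
  have hAA : (0 : ℝ) ≤ (2 ^ 4 * 5) * (Afar + Anear) := mul_nonneg (by norm_num) (add_nonneg hAfar0 hAnear0)
  -- per `Y`: Σ_{b'} f₀(b'; b, Y) = #Y · 𝟙[meet] · bd(b, Y) ≤ (Σ_{c ∈ b̃} 𝟙[c ∈ Y]) · e^{−κ₀ t} · 80 · (Afar + Anear)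
  have hY : ∀ Y : (recordDomSys F Mc k K).Dom, ∑ b' : TPt (F.P K).d (Sect2.domCount (F.P K) Mc (k + 1)), g3cStepWt F Mc k K c γ δ₀ κ' 0 b' (b, Y) ≤
      (∑ a ∈ ((g3cBlk F Mc k K b).1 : Finset _), (if a ∈ (Y.1 : Finset _) then Real.exp (-(κ₀ * torusTreeLen (Y.1 : Finset _))) else 0)) *
        ((2 ^ 4 * 5) * (Afar + Anear)) := by
    intro Y
    set t : ℝ := torusTreeLen (Y.1 : Finset _) with htdef
    have ht0 : 0 ≤ t := torusTreeLen_nonneg _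
    have hdj : (recordDomSys F Mc k K).dj Y = t := rfl
    -- the envelope and the step bound
    set G : ℝ := if 1 ≤ t then c * Real.exp (-(δ₀ * t)) * (1 / γ) else c * Nn with hGdef
    have hG0 : 0 ≤ G := by rw [hGdef]; split_ifs <;> positivity
    have hbd : g3cStepBd F Mc k K c γ δ₀ κ' (b, Y) ≤ G := by
      have := g3cStepBd_le (F := F) Mc k K κ' hc hγ hδ₀0 (b, Y)
      simpa only [hGdef, hdj] using this
    have hbd0 := g3cStepBd_nonneg Mc k K δ₀ κ' hc hγ (b, Y) (F := F)
    -- Σ_{b'} 𝟙[b' ∈ Y] = #Y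
    have hcount : ∑ b' : TPt (F.P K).d (Sect2.domCount (F.P K) Mc (k + 1)), (if b' ∈ (Y.1 : Finset _) then (1 : ℝ) else 0) = (Y.1 : Finset _).card := by
      rw [Finset.sum_boole, Finset.filter_mem_eq_inter, Finset.univ_inter]
    have hcard : ((Y.1 : Finset _).card : ℝ) ≤ 2 ^ 4 * 5 * Real.exp t := by
      rw [htdef]
      have h := G3CGeom.card_le_exp_torusTreeLen (d := (F.P K).d) Y.2.1 Y.2.2
      have h4 : (2 : ℝ) ^ (F.P K).d = 2 ^ 4 := by rw [T4Family.P_d]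
      rw [h4] at h
      exact h
    -- the meet indicator against the cubes of b̃
    have hmeet : (if ((Y.1 : Finset _) ∩ (g3cBlk F Mc k K b).1).Nonempty then (1 : ℝ) else 0) ≤
        ∑ a ∈ ((g3cBlk F Mc k K b).1 : Finset _), (if a ∈ (Y.1 : Finset _) then (1 : ℝ) else 0) := by
      split_ifs with h
      · obtain ⟨a, ha⟩ := h
        rw [Finset.mem_inter] at ha
        calc (1 : ℝ) = (if a ∈ (Y.1 : Finset _) then (1 : ℝ) else 0) := by rw [if_pos ha.1]
          _ ≤ ∑ a ∈ ((g3cBlk F Mc k K b).1 : Finset _), (if a ∈ (Y.1 : Finset _) then (1 : ℝ) else 0) :=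
              Finset.single_le_sum (f := fun a => if a ∈ (Y.1 : Finset _) then (1 : ℝ) else 0) (fun a _ => by positivity) ha.2
      · exact Finset.sum_nonneg fun a _ => by positivity
    -- exponent bookkeeping: 80 e^t · G ≤ e^{−κ₀ t} · 80 · (Afar + Anear)
    have hkey : (2 ^ 4 * 5 * Real.exp t) * G ≤ Real.exp (-(κ₀ * t)) * ((2 ^ 4 * 5) * (Afar + Anear)) := by
      rw [hGdef]
      split_ifs with hfar
      · have hexp : Real.exp t * Real.exp (-(δ₀ * t)) ≤ Real.exp (-(κ₀ * t)) * Real.exp (-(δ₀ - 0 - 1 - κ₀)) := by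
          rw [← Real.exp_add, ← Real.exp_add]
          apply Real.exp_le_exp.2
          nlinarith [mul_nonneg (by linarith : 0 ≤ δ₀ - 1 - κ₀) (by linarith : 0 ≤ t - 1)]
        calc 2 ^ 4 * 5 * Real.exp t * (c * Real.exp (-(δ₀ * t)) * (1 / γ))
            = (2 ^ 4 * 5) * (c * (1 / γ)) * (Real.exp t * Real.exp (-(δ₀ * t))) := by ring
          _ ≤ (2 ^ 4 * 5) * (c * (1 / γ)) * (Real.exp (-(κ₀ * t)) * Real.exp (-(δ₀ - 0 - 1 - κ₀))) := mul_le_mul_of_nonneg_left hexp (by positivity)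
          _ = Real.exp (-(κ₀ * t)) * ((2 ^ 4 * 5) * Afar) := by rw [hAfar]; ring
          _ ≤ Real.exp (-(κ₀ * t)) * ((2 ^ 4 * 5) * (Afar + Anear)) :=
              mul_le_mul_of_nonneg_left (mul_le_mul_of_nonneg_left (by linarith) (by positivity)) (Real.exp_pos _).le
      · have ht1 : t < 1 := lt_of_not_ge hfar
        have hexp : Real.exp t ≤ Real.exp (-(κ₀ * t)) * Real.exp (1 + κ₀) := by
          rw [← Real.exp_add]
          apply Real.exp_le_exp.2
          nlinarith [mul_nonneg hκ₀ (by linarith : 0 ≤ 1 - t)]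
        calc 2 ^ 4 * 5 * Real.exp t * (c * Nn) = (2 ^ 4 * 5) * (c * Nn) * Real.exp t := by ring
          _ ≤ (2 ^ 4 * 5) * (c * Nn) * (Real.exp (-(κ₀ * t)) * Real.exp (1 + κ₀)) := mul_le_mul_of_nonneg_left hexp (mul_nonneg (by norm_num) (mul_nonneg hc hNn0))
          _ = Real.exp (-(κ₀ * t)) * ((2 ^ 4 * 5) * Anear) := by rw [hAnear]; ring
          _ ≤ Real.exp (-(κ₀ * t)) * ((2 ^ 4 * 5) * (Afar + Anear)) :=
              mul_le_mul_of_nonneg_left (mul_le_mul_of_nonneg_left (by linarith) (by positivity)) (Real.exp_pos _).le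
    -- assemble the `Y`-term
    have hsum : ∑ b' : TPt (F.P K).d (Sect2.domCount (F.P K) Mc (k + 1)), g3cStepWt F Mc k K c γ δ₀ κ' 0 b' (b, Y) =
        ((Y.1 : Finset _).card : ℝ) * ((if ((Y.1 : Finset _) ∩ (g3cBlk F Mc k K b).1).Nonempty then (1 : ℝ) else 0) * g3cStepBd F Mc k K c γ δ₀ κ' (b, Y)) := by
      rw [← hcount, Finset.sum_mul]
      refine Finset.sum_congr rfl fun b' _ => ?_
      rw [g3cStepWt, zero_mul, Real.exp_zero, mul_one, mul_assoc]
    rw [hsum]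
    calc ((Y.1 : Finset _).card : ℝ) * ((if ((Y.1 : Finset _) ∩ (g3cBlk F Mc k K b).1).Nonempty then (1 : ℝ) else 0) * g3cStepBd F Mc k K c γ δ₀ κ' (b, Y))
        ≤ (2 ^ 4 * 5 * Real.exp t) * ((∑ a ∈ ((g3cBlk F Mc k K b).1 : Finset _), (if a ∈ (Y.1 : Finset _) then (1 : ℝ) else 0)) * G) :=
          mul_le_mul hcard (mul_le_mul hmeet hbd hbd0 (Finset.sum_nonneg fun a _ => by positivity))
            (mul_nonneg (by split_ifs <;> norm_num) hbd0) (by positivity)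
      _ = (∑ a ∈ ((g3cBlk F Mc k K b).1 : Finset _), (if a ∈ (Y.1 : Finset _) then (1 : ℝ) else 0)) * ((2 ^ 4 * 5 * Real.exp t) * G) := by ring
      _ ≤ (∑ a ∈ ((g3cBlk F Mc k K b).1 : Finset _), (if a ∈ (Y.1 : Finset _) then (1 : ℝ) else 0)) * (Real.exp (-(κ₀ * t)) * ((2 ^ 4 * 5) * (Afar + Anear))) :=
          mul_le_mul_of_nonneg_left hkey (Finset.sum_nonneg fun a _ => by split_ifs <;> norm_num)
      _ = (∑ a ∈ ((g3cBlk F Mc k K b).1 : Finset _), (if a ∈ (Y.1 : Finset _) then Real.exp (-(κ₀ * t)) else 0)) * ((2 ^ 4 * 5) * (Afar + Anear)) := by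
          rw [← mul_assoc, Finset.sum_mul]
          congr 1
          refine Finset.sum_congr rfl fun a _ => ?_
          split_ifs <;> simp
  -- sum over `Y`, swap, (1.26) per cube of b̃, `#b̃ ≤ 81`
  have hK : ∀ a : TPt (F.P K).d (Sect2.domCount (F.P K) Mc (k + 1)),
      ∑ Y : (recordDomSys F Mc k K).Dom, (if a ∈ (Y.1 : Finset _) then Real.exp (-(κ₀ * torusTreeLen (Y.1 : Finset _))) else 0) ≤ K₀ (4 * 2 ^ 4) (2 * 4) := by
    intro a
    have h := G3CGeom.sum_ite_mem_le (d := 4) (N := Sect2.domCount (F.P K) Mc (k + 1)) a (c₀ := (1 : ℝ)) zero_le_one le_rfl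
      (Finset.univ : Finset (recordDomSys F Mc k K).Dom)
    simp only [one_mul] at h
    exact h
  have hBlk : (((g3cBlk F Mc k K b).1 : Finset _).card : ℝ) ≤ ((3 ^ 4 * 3 ^ 4 : ℕ) : ℝ) := by
    have h : ((g3cBlk F Mc k K b).1 : Finset _).card ≤ 3 ^ (F.P K).d * 3 ^ (F.P K).d := by
      show (tcollar (tblock b)).card ≤ _
      exact (card_tcollar_le _).trans (Nat.mul_le_mul_left _ (card_tblock_le b))
    exact_mod_cast h
  calc ∑ b' : TPt (F.P K).d (Sect2.domCount (F.P K) Mc (k + 1)), ∑ Y : (recordDomSys F Mc k K).Dom, g3cStepWt F Mc k K c γ δ₀ κ' 0 b' (b, Y)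
      = ∑ Y : (recordDomSys F Mc k K).Dom, ∑ b' : TPt (F.P K).d (Sect2.domCount (F.P K) Mc (k + 1)), g3cStepWt F Mc k K c γ δ₀ κ' 0 b' (b, Y) := Finset.sum_comm
    _ ≤ ∑ Y : (recordDomSys F Mc k K).Dom, (∑ a ∈ ((g3cBlk F Mc k K b).1 : Finset _), (if a ∈ (Y.1 : Finset _) then Real.exp (-(κ₀ * torusTreeLen (Y.1 : Finset _))) else 0)) *
          ((2 ^ 4 * 5) * (Afar + Anear)) := Finset.sum_le_sum fun Y _ => hY Y
    _ = (∑ a ∈ ((g3cBlk F Mc k K b).1 : Finset _), ∑ Y : (recordDomSys F Mc k K).Dom, (if a ∈ (Y.1 : Finset _) then Real.exp (-(κ₀ * torusTreeLen (Y.1 : Finset _))) else 0)) *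
          ((2 ^ 4 * 5) * (Afar + Anear)) := by rw [← Finset.sum_mul, Finset.sum_comm]
    _ ≤ (∑ a ∈ ((g3cBlk F Mc k K b).1 : Finset _), K₀ (4 * 2 ^ 4) (2 * 4)) * ((2 ^ 4 * 5) * (Afar + Anear)) :=
        mul_le_mul_of_nonneg_right (Finset.sum_le_sum fun a _ => hK a) hAA
    _ = (((g3cBlk F Mc k K b).1 : Finset _).card : ℝ) * K₀ (4 * 2 ^ 4) (2 * 4) * ((2 ^ 4 * 5) * (Afar + Anear)) := by rw [Finset.sum_const, nsmul_eq_mul]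
    _ ≤ ((3 ^ 4 * 3 ^ 4 : ℕ) : ℝ) * K₀ (4 * 2 ^ 4) (2 * 4) * ((2 ^ 4 * 5) * (Afar + Anear)) :=
        mul_le_mul_of_nonneg_right (mul_le_mul_of_nonneg_right hBlk (K₀_pos (4 * 2 ^ 4 : ℝ) (2 * 4)).le) hAA
    _ = g3cLam F Mc c γ δ₀ κ' 0 := by rw [g3cLam, hAfar, hAnear, zero_mul, Real.exp_zero]; ring

/-- `Λ` is monotone in the target rate: `Λ(…, 0) ≤ Λ(…, κt)` for `κt ≥ 0`. [folklore] -/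
theorem g3cLam_zero_le (Mc : ℕ) {c γ κt : ℝ} (δ₀ κ' : ℝ) (hc : 0 ≤ c) (hγ : 0 < γ) (hκt : 0 ≤ κt) :
    g3cLam F Mc c γ δ₀ κ' 0 ≤ g3cLam F Mc c γ δ₀ κ' κt := by
  unfold g3cLam
  have hK := (K₀_pos (4 * 2 ^ 4 : ℝ) (2 * 4)).le
  have h1 : Real.exp (0 * (((3 ^ 4 * 3 ^ 4 : ℕ) : ℝ) + 4)) ≤ Real.exp (κt * (((3 ^ 4 * 3 ^ 4 : ℕ) : ℝ) + 4)) :=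
    Real.exp_le_exp.2 (by rw [zero_mul]; positivity)
  have h2 : Real.exp (-(δ₀ - 0 - 1 - kappa₀ (4 * 2 ^ 4) (2 * 4))) ≤ Real.exp (-(δ₀ - κt - 1 - kappa₀ (4 * 2 ^ 4) (2 * 4))) := Real.exp_le_exp.2 (by linarith)
  have h3 : c * (1 / γ) * Real.exp (-(δ₀ - 0 - 1 - kappa₀ (4 * 2 ^ 4) (2 * 4))) +
      Real.exp (1 + kappa₀ (4 * 2 ^ 4) (2 * 4)) * (c * (((3 ^ 4 * 3 ^ 4 * (3 * 4 * (F.L * Mc) ^ 4) : ℕ) : ℝ) * (Real.exp (-(κ' * ((F.L * Mc : ℕ) : ℝ))) / (γ / 2)))) ≤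
      c * (1 / γ) * Real.exp (-(δ₀ - κt - 1 - kappa₀ (4 * 2 ^ 4) (2 * 4))) +
      Real.exp (1 + kappa₀ (4 * 2 ^ 4) (2 * 4)) * (c * (((3 ^ 4 * 3 ^ 4 * (3 * 4 * (F.L * Mc) ^ 4) : ℕ) : ℝ) * (Real.exp (-(κ' * ((F.L * Mc : ℕ) : ℝ))) / (γ / 2)))) :=
    add_le_add (mul_le_mul_of_nonneg_left h2 (by positivity : (0 : ℝ) ≤ c * (1 / γ))) le_rfl
  have h0 : 0 ≤ c * (1 / γ) * Real.exp (-(δ₀ - 0 - 1 - kappa₀ (4 * 2 ^ 4) (2 * 4))) +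
      Real.exp (1 + kappa₀ (4 * 2 ^ 4) (2 * 4)) * (c * (((3 ^ 4 * 3 ^ 4 * (3 * 4 * (F.L * Mc) ^ 4) : ℕ) : ℝ) * (Real.exp (-(κ' * ((F.L * Mc : ℕ) : ℝ))) / (γ / 2)))) := by positivity
  exact mul_le_mul (mul_le_mul_of_nonneg_left h1 (by positivity)) h3 h0 (by positivity)

end Columns

/-! ## §4  `‖R‖ ≤ Λ₀` and the trace identity `Σ_X W(X) = Tr A⁻¹` -/

section Neumann

variable {F : T4Family}
variable {a₀ δ₀ c₀ γ₀ γ₁ δ₁ : ℝ} {Mc : ℕ} {α₀ α₁ ε₂₉ : ℝ} {k : ℕ}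
variable {TC : (n : ℕ) → Sect2.CPair (F.P (recordK₀ F Mc k + n)) (MatA 2) → FluctIdx F k (recordK₀ F Mc k + n) → FluctIdx F k (recordK₀ F Mc k + n) → ℂ}
variable {TY : (n : ℕ) → (recordDomSys F Mc k (recordK₀ F Mc k + n)).Dom → Sect2.CPair (F.P (recordK₀ F Mc k + n)) (MatA 2) →
  FluctIdx F k (recordK₀ F Mc k + n) → FluctIdx F k (recordK₀ F Mc k + n) → ℂ}
variable {TZY : Finset (Fin 4 → ℤ) → IntBondCfg → ((Fin 4 → ℤ) × Fin 4) × Fin 3 → ((Fin 4 → ℤ) × Fin 4) × Fin 3 → ℂ}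
variable {AdM : (n : ℕ) → (Site (F.P (recordK₀ F Mc k + n)) 0 → (MatA 2)ˣ) →
  Matrix (FluctIdx F k (recordK₀ F Mc k + n)) (FluctIdx F k (recordK₀ F Mc k + n)) ℂ}
variable {AdZ : ((Fin 4 → ℤ) → (MatA 2)ˣ) → (Fin 4 → ℤ) × Fin 4 → Matrix (Fin 3) (Fin 3) ℂ}

/-- ★ **`‖R(x, φ)‖ ≤ Λ₀ := g3cLam(…, 0)`** at a pair of `G3CPt … X_full φ`, `x ≥ 0` (block Schur test over the sharp partition). [cite: Balaban1985BackgroundPropagators, (3.96) p.411] -/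
theorem l2_opNorm_g3cR_le (hP : P0CarrierClauses F a₀ δ₀ c₀ γ₀ γ₁ Mc α₀ α₁ ε₂₉ k TC TY TZY AdM AdZ) (hMc : McGuard F Mc) {c γ δ₁' κ' : ℝ} (hc : 0 ≤ c)
    (hγ : 0 < γ) (hδ₁ : 0 < δ₁') (hδ₀ : kappa₀ (4 * 2 ^ 4) (2 * 4) + 1 ≤ δ₀) (hκ : 0 ≤ κ') (hκδ : 2 * κ' ≤ δ₁') (hκc : 4 * κ' * (c * K₀ (4 * 2 ^ 4) (2 * 4)) ≤ γ * δ₁')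
    (n : ℕ) {φ : Sect2.CPair (F.P (recordK₀ F Mc k + n)) (MatA 2)}
    (hpt : G3CPt F Mc k (recordK₀ F Mc k + n) (TY n) c γ δ₀ δ₁' (g3cFull F Mc k (recordK₀ F Mc k + n)) φ) {x : ℝ} (hx : 0 ≤ x) :
    ‖g3cR F Mc k (recordK₀ F Mc k + n) (TC n) (TY n) x φ‖ ≤ g3cLam F Mc c γ δ₀ κ' 0 := by
  have hδ₀' : kappa₀ (4 * 2 ^ 4) (2 * 4) ≤ δ₀ := by linarith
  have hΛ0 : 0 ≤ g3cLam F Mc c γ δ₀ κ' 0 := by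
    unfold g3cLam; have := K₀_pos (4 * 2 ^ 4 : ℝ) (2 * 4); positivity
  refine G3CCT.l2_opNorm_le_of_blockSchur (fun i : NonB0Idx F k (recordK₀ F Mc k + n) => cubeOfSite F Mc k (recordK₀ F Mc k + n) (blockOf i.1.1.src)) _
    (fun b' b => ∑ Y : (recordDomSys F Mc k (recordK₀ F Mc k + n)).Dom, g3cStepWt F Mc k (recordK₀ F Mc k + n) c γ δ₀ κ' 0 b' (b, Y))
    (fun b' b => Finset.sum_nonneg fun Y _ => g3cStepWt_nonneg Mc k _ δ₀ κ' 0 hc hγ b' (b, Y)) (fun b' b => ?_) hΛ0 (fun b' => ?_) (fun b => ?_)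
  · rw [← g3cInd_eq_diagonal, ← g3cInd_eq_diagonal]
    exact norm_ind_mul_g3cR_mul_ind_le hP hMc hc hγ hδ₁ hδ₀' hκ hκδ hκc n hpt hx b' b
  · rw [← Fintype.sum_prod_type]
    exact sum_g3cStepWt_le Mc k _ κ' hc hγ le_rfl (by linarith) b'
  · exact sum_g3cStepWt_fst_le Mc k _ κ' hc hγ hδ₀ b

/-- **Summability of the walk series at a pair of `G3CPt … X φ`** with `Λ ≤ ½`: `‖(−1)ᵐW_m(X)‖ ≤ B_X·2^{−m}`. [cite: Balaban1985BackgroundPropagators, (3.96) p.411] -/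
theorem summable_g3cWm (hP : P0CarrierClauses F a₀ δ₀ c₀ γ₀ γ₁ Mc α₀ α₁ ε₂₉ k TC TY TZY AdM AdZ) (hMc : McGuard F Mc) {c γ δ₁' κ' κt : ℝ} (hc : 0 ≤ c)
    (hγ : 0 < γ) (hδ₁ : 0 < δ₁') (hκ : 0 ≤ κ') (hκδ : 2 * κ' ≤ δ₁') (hκc : 4 * κ' * (c * K₀ (4 * 2 ^ 4) (2 * 4)) ≤ γ * δ₁')
    (hκt : 0 ≤ κt) (hδ₀ : kappa₀ (4 * 2 ^ 4) (2 * 4) + κt + 1 ≤ δ₀) (hΛ : g3cLam F Mc c γ δ₀ κ' κt ≤ 1 / 2)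
    (n : ℕ) {X : (recordDomSys F Mc k (recordK₀ F Mc k + n)).Dom} {φ : Sect2.CPair (F.P (recordK₀ F Mc k + n)) (MatA 2)}
    (hpt : G3CPt F Mc k (recordK₀ F Mc k + n) (TY n) c γ δ₀ δ₁' X φ) {x : ℝ} (hx : 0 ≤ x) :
    Summable (fun m : ℕ => (-1 : ℂ) ^ m * g3cWm F Mc k (recordK₀ F Mc k + n) (TY n) x φ m X) := by
  have hδ₀' : kappa₀ (4 * 2 ^ 4) (2 * 4) ≤ δ₀ := by linarith
  set B : ℝ := (3 * (F.P (recordK₀ F Mc k + n)).d * (F.L * Mc) ^ (F.P (recordK₀ F Mc k + n)).d : ℕ) * (1 / γ) *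
        Real.exp (κt * ((3 ^ (F.P (recordK₀ F Mc k + n)).d * 3 ^ (F.P (recordK₀ F Mc k + n)).d : ℕ) : ℝ)) *
        ((X.1 : Finset _).card : ℝ) * Real.exp (-(κt * (recordDomSys F Mc k (recordK₀ F Mc k + n)).dj X)) with hB
  have hΛ0 : 0 ≤ g3cLam F Mc c γ δ₀ κ' κt := by
    unfold g3cLam; have := K₀_pos (4 * 2 ^ 4 : ℝ) (2 * 4); positivity
  refine Summable.of_norm_bounded (g := fun m : ℕ => B * (1 / 2) ^ m) ((summable_geometric_of_lt_one (by norm_num) (by norm_num)).mul_left B) fun m => ?_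
  rw [norm_mul, norm_pow, norm_neg, norm_one, one_pow, one_mul]
  refine (norm_g3cWm_le hP hMc hc hγ hδ₁ hδ₀' hκ hκδ hκc hκt n hpt hx m (sum_g3cStepWt_le Mc k _ κ' hc hγ hκt hδ₀)).trans ?_
  rw [← hB]
  exact mul_le_mul_of_nonneg_left (pow_le_pow_left₀ hΛ0 hΛ m) (by positivity)

/-- The walk piece is the sum of its series: `HasSum (m ↦ (−1)ᵐW_m(X)) (W(X))`. [folklore] -/
theorem hasSum_g3cW (hP : P0CarrierClauses F a₀ δ₀ c₀ γ₀ γ₁ Mc α₀ α₁ ε₂₉ k TC TY TZY AdM AdZ) (hMc : McGuard F Mc) {c γ δ₁' κ' κt : ℝ} (hc : 0 ≤ c)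
    (hγ : 0 < γ) (hδ₁ : 0 < δ₁') (hκ : 0 ≤ κ') (hκδ : 2 * κ' ≤ δ₁') (hκc : 4 * κ' * (c * K₀ (4 * 2 ^ 4) (2 * 4)) ≤ γ * δ₁')
    (hκt : 0 ≤ κt) (hδ₀ : kappa₀ (4 * 2 ^ 4) (2 * 4) + κt + 1 ≤ δ₀) (hΛ : g3cLam F Mc c γ δ₀ κ' κt ≤ 1 / 2)
    (n : ℕ) {X : (recordDomSys F Mc k (recordK₀ F Mc k + n)).Dom} {φ : Sect2.CPair (F.P (recordK₀ F Mc k + n)) (MatA 2)}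
    (hpt : G3CPt F Mc k (recordK₀ F Mc k + n) (TY n) c γ δ₀ δ₁' X φ) {x : ℝ} (hx : 0 ≤ x) :
    HasSum (fun m : ℕ => (-1 : ℂ) ^ m * g3cWm F Mc k (recordK₀ F Mc k + n) (TY n) x φ m X) (g3cW F Mc k (recordK₀ F Mc k + n) (TY n) x φ X) :=
  (summable_g3cWm hP hMc hc hγ hδ₁ hκ hκδ hκc hκt hδ₀ hΛ n hpt hx).hasSum

/-- ★★ **THE TRACE IDENTITY `Σ_X W(X)(x, φ) = Tr (x·1 + [TC n φ]_{nonB₀})⁻¹`** at every pair of `G3CPt … X_full φ` with `Λ ≤ ½`, `x ≥ 0` — the resummed random walk expansion (24)–(25) IS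
the resolvent trace. [cite: Balaban1985UV3, (23)–(25) p.262; Balaban1985BackgroundPropagators, (3.90) p.409, (3.96) p.411] -/
theorem sum_g3cW_eq_trace_inv (hP : P0CarrierClauses F a₀ δ₀ c₀ γ₀ γ₁ Mc α₀ α₁ ε₂₉ k TC TY TZY AdM AdZ) (hMc : McGuard F Mc) {c γ δ₁' κ' κt : ℝ} (hc : 0 ≤ c)
    (hγ : 0 < γ) (hδ₁ : 0 < δ₁') (hκ : 0 ≤ κ') (hκδ : 2 * κ' ≤ δ₁') (hκc : 4 * κ' * (c * K₀ (4 * 2 ^ 4) (2 * 4)) ≤ γ * δ₁')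
    (hκt : 0 ≤ κt) (hδ₀ : kappa₀ (4 * 2 ^ 4) (2 * 4) + κt + 1 ≤ δ₀) (hΛ : g3cLam F Mc c γ δ₀ κ' κt ≤ 1 / 2)
    (n : ℕ) {φ : Sect2.CPair (F.P (recordK₀ F Mc k + n)) (MatA 2)}
    (hpt : G3CPt F Mc k (recordK₀ F Mc k + n) (TY n) c γ δ₀ δ₁' (g3cFull F Mc k (recordK₀ F Mc k + n)) φ) {x : ℝ} (hx : 0 ≤ x) :
    ∑ X : (recordDomSys F Mc k (recordK₀ F Mc k + n)).Dom, g3cW F Mc k (recordK₀ F Mc k + n) (TY n) x φ X =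
      (((x : ℂ) • (1 : Matrix (NonB0Idx F k (recordK₀ F Mc k + n)) (NonB0Idx F k (recordK₀ F Mc k + n)) ℂ) +
        nonB0Block F k (recordK₀ F Mc k + n) (TC n φ))⁻¹).trace := by
  -- the series of the finite sums
  have h1 : HasSum (fun m : ℕ => ∑ X : (recordDomSys F Mc k (recordK₀ F Mc k + n)).Dom, (-1 : ℂ) ^ m * g3cWm F Mc k (recordK₀ F Mc k + n) (TY n) x φ m X)
      (∑ X : (recordDomSys F Mc k (recordK₀ F Mc k + n)).Dom, g3cW F Mc k (recordK₀ F Mc k + n) (TY n) x φ X) :=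
    hasSum_sum fun X _ => hasSum_g3cW hP hMc hc hγ hδ₁ hκ hκδ hκc hκt hδ₀ hΛ n (hpt.mono (fun c _ => mem_g3cFull F Mc k _ c)) hx
  -- the Neumann series of the parametrix
  have hR : ‖g3cR F Mc k (recordK₀ F Mc k + n) (TC n) (TY n) x φ‖ < 1 := by
    have h := l2_opNorm_g3cR_le hP hMc hc hγ hδ₁ (by linarith) hκ hκδ hκc n hpt hx
    have hmono := g3cLam_zero_le (F := F) Mc δ₀ κ' hc hγ hκt
    linarith
  have hpar := g3c_parametrix_of_coer hP hγ hMc n (fun q => hpt.2 _ (fun c _ => mem_g3cFull F Mc k _ c)) hx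
  have h2 := G3CInv.hasSum_parametrix_trace_block hpar hR (Finset.univ : Finset (NonB0Idx F k (recordK₀ F Mc k + n)))
  -- identify the terms
  have h3 : ∀ m : ℕ, ∑ X : (recordDomSys F Mc k (recordK₀ F Mc k + n)).Dom, (-1 : ℂ) ^ m * g3cWm F Mc k (recordK₀ F Mc k + n) (TY n) x φ m X =
      ∑ i ∈ (Finset.univ : Finset (NonB0Idx F k (recordK₀ F Mc k + n))),
        (g3cC0 F Mc k (recordK₀ F Mc k + n) (TY n) x φ * (-g3cR F Mc k (recordK₀ F Mc k + n) (TC n) (TY n) x φ) ^ m) i i := by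
    intro m
    rw [← Finset.mul_sum, sum_g3cWm_eq_trace hP hMc n x φ m]
    have hneg : (-g3cR F Mc k (recordK₀ F Mc k + n) (TC n) (TY n) x φ) = (-1 : ℂ) • g3cR F Mc k (recordK₀ F Mc k + n) (TC n) (TY n) x φ :=
      (neg_one_smul ℂ _).symm
    rw [hneg, smul_pow, Matrix.mul_smul]
    simp only [Matrix.smul_apply, smul_eq_mul]
    rw [← Finset.mul_sum]
    rfl
  simp_rw [h3] at h1
  have h4 := h1.unique h2
  rw [h4]
  rfl

/-- ★ **`EG = W` AT EVERY PAIR OF `G3CPt … X_full φ` (with `Λ ≤ ½`)**, for every `X` — in particular on the open neighbourhood `O_{X_full}`. [cite: Balaban1985UV3, (23)–(25) p.262] -/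
theorem g3cEG_eq_g3cW_of_pt (hP : P0CarrierClauses F a₀ δ₀ c₀ γ₀ γ₁ Mc α₀ α₁ ε₂₉ k TC TY TZY AdM AdZ) (hMc : McGuard F Mc) {c γ δ₁' κ' κt : ℝ} (hc : 0 ≤ c)
    (hγ : 0 < γ) (hδ₁ : 0 < δ₁') (hκ : 0 ≤ κ') (hκδ : 2 * κ' ≤ δ₁') (hκc : 4 * κ' * (c * K₀ (4 * 2 ^ 4) (2 * 4)) ≤ γ * δ₁')
    (hκt : 0 ≤ κt) (hδ₀ : kappa₀ (4 * 2 ^ 4) (2 * 4) + κt + 1 ≤ δ₀) (hΛ : g3cLam F Mc c γ δ₀ κ' κt ≤ 1 / 2)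
    (n : ℕ) {φ : Sect2.CPair (F.P (recordK₀ F Mc k + n)) (MatA 2)}
    (hpt : G3CPt F Mc k (recordK₀ F Mc k + n) (TY n) c γ δ₀ δ₁' (g3cFull F Mc k (recordK₀ F Mc k + n)) φ) {x : ℝ} (hx : 0 ≤ x)
    (X : (recordDomSys F Mc k (recordK₀ F Mc k + n)).Dom) :
    g3cEG F Mc k (recordK₀ F Mc k + n) (TC n) (TY n) x X φ = g3cW F Mc k (recordK₀ F Mc k + n) (TY n) x φ X :=
  g3cEG_eq_g3cW_of_sum_eq Mc k (TC n) (TY n) x φ (sum_g3cW_eq_trace_inv hP hMc hc hγ hδ₁ hκ hκδ hκc hκt hδ₀ hΛ n hpt hx) X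

end Neumann

end Summit.QuantumFields.YangMills.Theorems.BalabanUVNodesPortS1

end
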